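import Summits.ResolutionOfSingularities.ResolutionOfSingularities.Theorems.FrobeniusClosingSteerStrippedThreadChainExistsOut
import Summits.ResolutionOfSingularities.ResolutionOfSingularities.Theorems.FrobeniusClosingSteerPointTailChain
import HarnessLib

/-!
# Point tails WITH OUTPUT: the K♭ v2.2-perfect chain of an F-B♮ tail, exposed (Θ♮ engine re-opened; Theses-free, def-free)

W4.1, crux `Steer` (stmt-ResolutionOfSingularities-16345), §σ2.28 (e2) `PointTailPersistTwoN` (res-L0-w41-plan-1 RULING 116b: «Θ♮ packaging
re-opened WITH AN OUTPUT; pv-011 supplies the variant»). Same hypotheses as `PointTail.not_noEternalStrippedChainHP_of_pointTail` (p528265);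
conclusion = the chain itself together with (O1) the members `S m = R (j (m+1))` (the run's members AT the point steps), (O2) the visits `j`
(strictly increasing, every `j k` a point step, every non-visit beyond `j 0` a positive step), (O3) `x m` = an exceptional parameter of the point
step `j (m+1)` (in `𝔪`, non-zero, of maximal `O`-value on `𝔪`), and every member clause of `NoEternalStrippedRadicandChainHP p n` (regular,
excellent, dimension, quadratic transform, span, law, multiplicity, H, perfect residue field, isolated). A chain-level conclusion about
`span {x m}` (strat-2's (e1) `NoTangentialTailHP`) thus reads on the run ((e2)). OURS (the W4.1 engine; seat res-D-pv-011).
[cite: Cutkosky2014, §2.1] [cite: NovacoskiSpivakovsky2014, Def. 2.11] [cite: Matsumura1987, Thm. 19.3, Thm. 20.3]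
-/

noncomputable section

-- `Summit.<S>.<S>.…` duplicates the summit name by design (single-problem summit).
set_option linter.dupNamespace false

open Polynomial IsLocalRing Literature.AlgebraicGeometry.Resolution

namespace Summit.ResolutionOfSingularities.ResolutionOfSingularities.Theorems.SwitchingDichotomy.PointTail

variable {k : Type} {K : Type} [Field k] [Field K] [Algebra k K]

/-- **Θ♮ engine with output.** See the module docstring. OURS. [cite: Cutkosky2014, §2.1] [cite: Matsumura1987, Thm. 19.3, Thm. 20.3] -/
theorem exists_chainHP_of_pointTail (p : ℕ) [hp : Fact p.Prime] [CharP K p]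
    (O : ValuationSubring K) (A₀ : Subalgebra k K) (h₀ : A₀.toSubring ≤ O.toSubring) (hfg : A₀.FG)
    (R : ℕ → Subring K) (P : (i : ℕ) → Ideal (R i)) (s : ℕ → K) (n : ℕ)
    (hR0 : R 0 = locAtCentre A₀.toSubring O)
    (hbl : ∀ i, IsLocalBlowupAlong O (R i) (P i) (R (i + 1)))
    (hst : ∀ i, ∃ x g : K, ((∃ hx : x ∈ R i, (⟨x, hx⟩ : R i) ∈ P i) ∧ x ≠ 0 ∧
      ∀ y : R i, y ∈ P i → O.valuation (y : K) ≤ O.valuation x) ∧ g ∈ R i ∧ s i = x * s (i + 1) + g)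
    (hsp : ∀ i, s i ^ p ∈ R i)
    (hregR : ∀ i, IsRegularLocalRing (R i))
    (hdim : ∀ i, ringKrullDim (R i) = n)
    (hvis : ∀ i, (∃ _ : IsLocalRing (R i), P i ≠ maximalIdeal (R i)) →
      (P i).IsPrime ∧
      (∀ _ : (P i).IsPrime, ¬ IsRegularLocalRing (AdjoinRoot ((X : (Localization.AtPrime (P i))[X]) ^ p -
          C (algebraMap (R i) (Localization.AtPrime (P i)) ⟨s i ^ p, hsp i⟩)))))
    (hpt : ∀ i₀ : ℕ, ∃ i, i₀ ≤ i ∧ ∃ _ : IsLocalRing (R i), P i = maximalIdeal (R i))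
    (hpos : ∀ i₀ : ℕ, ∃ i, i₀ ≤ i ∧ ∃ _ : IsLocalRing (R i), P i ≠ maximalIdeal (R i))
    (hfin2 : ∃ m₀ : ℕ, ∀ m, m₀ ≤ m → (∃ _ : IsLocalRing (R m), P m ≠ maximalIdeal (R m)) → (P m).height ≤ 1)
    (hmult : ∃ i₀ : ℕ, ∀ i, i₀ ≤ i → (∃ _ : IsLocalRing (R i), P i = maximalIdeal (R i)) →
      ∃ g : R i, (⟨s i ^ p, hsp i⟩ : R i) - g ^ p ∈ P i ^ p)
    (hiso : ∃ i₀ : ℕ, ∀ i, i₀ ≤ i → (∃ _ : IsLocalRing (R i), P i = maximalIdeal (R i)) →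
      ∀ (Q : Ideal (AdjoinRoot ((X : (R i)[X]) ^ p - C (⟨s i ^ p, hsp i⟩ : R i)))) [Q.IsPrime],
        (∃ Q' : Ideal (AdjoinRoot ((X : (R i)[X]) ^ p - C (⟨s i ^ p, hsp i⟩ : R i))), Q'.IsPrime ∧ Q < Q') →
        IsRegularLocalRing (Localization.AtPrime Q))
    (hCD : ∀ (S S' : Subring K) [IsRegularLocalRing S] [IsRegularLocalRing S'] (hle : S ≤ S'),
      IsQuadraticTransform S S' → ∀ (ξ : K) (hξ : ξ ∈ S'),
      Ideal.span ((fun y : S => (⟨(y : K), hle y.2⟩ : S')) '' (maximalIdeal S : Set S)) = Ideal.span {(⟨ξ, hξ⟩ : S')} →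
      ∀ (f G F : K), f ∈ S → G ∈ S' → F ∈ S' → ∀ e : ℕ, 1 ≤ e → f - G ^ p = ξ ^ (p * e) * F →
      ∃ g h : K, g ∈ S ∧ h ∈ S' ∧ G = g + ξ ^ e * h)
    (hH : ∀ (i : ℕ) (T : Subring K) [IsLocalRing T], T = R i → ∀ f g : T,
      (∀ N : ℕ, (∀ h : T, f - h ^ p ∉ maximalIdeal T ^ (N + 1)) → f - g ^ p ∈ maximalIdeal T ^ N →
        ∃ D : Derivation ℤ T T, D f ∉ maximalIdeal T ^ N ∨
          ((∀ y ∈ maximalIdeal T, D y ∈ maximalIdeal T) ∧ D f ∉ maximalIdeal T ^ (N + 1))))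
    (hperf : ∀ (i : ℕ) (T : Subring K) [IsLocalRing T], T = R i → PerfectField (IsLocalRing.ResidueField T)) :
    ∃ (j : ℕ → ℕ), StrictMono j ∧ (∀ l, ∃ _ : IsLocalRing (R (j l)), P (j l) = maximalIdeal (R (j l))) ∧
      (∀ m, j 0 ≤ m → (∀ l, m ≠ j l) → ∃ _ : IsLocalRing (R m), P m ≠ maximalIdeal (R m)) ∧
      ∃ (S : ℕ → Subring K) (_ : ∀ m, IsLocalRing (S m)) (hle : ∀ m, S m ≤ S (m + 1)) (f g : ∀ m, S m)
        (x : ∀ m, S (m + 1)) (e : ℕ → ℕ),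
        (∀ m, 1 ≤ e m) ∧ (∀ m₀, ∃ m, m₀ ≤ m ∧ 2 ≤ e m) ∧
        (∀ m, IsRegularLocalRing (S m)) ∧ (∀ m, IsExcellentRing (S m)) ∧ (∀ m, ringKrullDim (S m) = n) ∧
        (∀ m, IsQuadraticTransform (S m) (S (m + 1))) ∧
        (∀ m, Ideal.span ((fun y : S m => (⟨(y : K), hle m y.2⟩ : S (m + 1))) '' (maximalIdeal (S m) : Set (S m)))
            = Ideal.span {x m}) ∧
        (∀ m, ((f (m + 1) : S (m + 1)) : K) * ((x m : S (m + 1)) : K) ^ (p * e m) =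
            ((f m : S m) : K) - ((g m : S m) : K) ^ p) ∧
        (∀ m, ∃ h : S m, f m - h ^ p ∈ maximalIdeal (S m) ^ p) ∧
        (∀ m, ∀ N : ℕ, (∀ h : S m, f m - h ^ p ∉ maximalIdeal (S m) ^ (N + 1)) →
          f m - (g m) ^ p ∈ maximalIdeal (S m) ^ N →
          ∃ D : Derivation ℤ (S m) (S m), D (f m) ∉ maximalIdeal (S m) ^ N ∨
            ((∀ y ∈ maximalIdeal (S m), D y ∈ maximalIdeal (S m)) ∧ D (f m) ∉ maximalIdeal (S m) ^ (N + 1))) ∧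
        (∀ m, PerfectField (IsLocalRing.ResidueField (S m))) ∧
        (∀ m, ∀ (Q : Ideal (AdjoinRoot ((X : (S m)[X]) ^ p - C (f m)))) [Q.IsPrime],
            (∃ Q' : Ideal (AdjoinRoot ((X : (S m)[X]) ^ p - C (f m))), Q'.IsPrime ∧ Q < Q') →
            IsRegularLocalRing (Localization.AtPrime Q)) ∧
        (∀ m, S m = R (j (m + 1))) ∧
        (∀ m, (∃ hx : ((x m : S (m + 1)) : K) ∈ R (j (m + 1)),
            ∃ _ : IsLocalRing (R (j (m + 1))), (⟨((x m : S (m + 1)) : K), hx⟩ : R (j (m + 1))) ∈ maximalIdeal (R (j (m + 1)))) ∧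
          ((x m : S (m + 1)) : K) ≠ 0 ∧
          ∀ y : R (j (m + 1)), (∃ _ : IsLocalRing (R (j (m + 1))), y ∈ maximalIdeal (R (j (m + 1)))) →
            O.valuation (y : K) ≤ O.valuation ((x m : S (m + 1)) : K)) := by
  classical
  haveI hloc : ∀ i, IsLocalRing (R i) := fun i => by haveI := hregR i; infer_instance
  have hmono : Monotone R := monotone_nat_of_le_succ fun i => (hbl i).isLocalBlowup.le
  -- ### members are their own local rings at the centre of `O`
  have hRO0 : R 0 ≤ O.toSubring := by rw [hR0]; exact locAtCentre_le h₀
  have hloc0 : locAtCentre (R 0) O = R 0 := by rw [hR0, locAtCentre_locAtCentre]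
  have hrun := NoSingularCarrier.le_and_locAtCentre_eq_of_run R P hRO0 hloc0 hbl
  have hval : ∀ i (a : R i), a ∈ maximalIdeal (R i) ↔ O.valuation (a : K) < 1 := fun i =>
    NoSingularCarrier.mem_maximalIdeal_iff_of_locAtCentre_eq (hrun i).1 (hrun i).2
  -- ### the thresholds and the visits = point steps beyond them
  obtain ⟨m₀, hm₀⟩ := hfin2
  obtain ⟨i₁, hi₁⟩ := hmult
  obtain ⟨i₂, hi₂⟩ := hiso
  set N₀ : ℕ := m₀ + i₁ + i₂ with hN₀
  let J : Set ℕ := {i | N₀ ≤ i ∧ P i = maximalIdeal (R i)}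
  have hJ : J.Infinite := by
    refine Set.infinite_of_forall_exists_gt fun a => ?_
    obtain ⟨i, hi, _, hP⟩ := hpt (N₀ + a + 1)
    exact ⟨i, ⟨by omega, hP⟩, by omega⟩
  have hjmono : StrictMono (Nat.nth (· ∈ J)) := Nat.nth_strictMono hJ
  set j : ℕ → ℕ := Nat.nth (· ∈ J) with hjdef
  have hjmem : ∀ k, j k ∈ J := fun k => Nat.nth_mem_of_infinite hJ k
  have hjN₀ : ∀ k, N₀ ≤ j k := fun k => (hjmem k).1
  have hjP : ∀ k, P (j k) = maximalIdeal (R (j k)) := fun k => (hjmem k).2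
  have hjsurj : ∀ m ∈ J, ∃ k, j k = m := fun m hm => ⟨Nat.count (· ∈ J) m, Nat.nth_count hm⟩
  -- a non-visit beyond `j 0` is a positive step
  have hposnv : ∀ m, j 0 ≤ m → (∀ k, m ≠ j k) → P m ≠ maximalIdeal (R m) := by
    intro m hm hnv hP
    obtain ⟨kk, hkk⟩ := hjsurj m ⟨(hjN₀ 0).trans hm, hP⟩
    exact hnv kk hkk.symm
  -- ### the engine's hypotheses on the trivial thread `W m = 𝔪_{R m}`
  have hWcomap : ∀ m, j 0 ≤ m → ∃ h : R m ≤ R (m + 1),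
      Ideal.comap (Subring.inclusion h) (maximalIdeal (R (m + 1))) = maximalIdeal (R m) := by
    intro m _
    refine ⟨hmono (Nat.le_succ m), ?_⟩
    ext y
    rw [Ideal.mem_comap, hval (m + 1), hval m]
    rfl
  have hhit : ∀ m, j 0 ≤ m → (∀ k, m ≠ j k) → P m ≤ maximalIdeal (R m) → ∃ _ : (P m).IsPrime, (P m).height ≤ 1 ∧
      ¬ IsRegularLocalRing (AdjoinRoot ((X : (Localization.AtPrime (P m))[X]) ^ p -
        C (algebraMap (R m) (Localization.AtPrime (P m)) ⟨s m ^ p, hsp m⟩))) := by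
    intro m hm hnv _
    have hne : P m ≠ maximalIdeal (R m) := hposnv m hm hnv
    obtain ⟨hPm, hsing⟩ := hvis m ⟨hloc m, hne⟩
    exact ⟨hPm, hm₀ m (by have := hjN₀ 0; omega) ⟨hloc m, hne⟩, hsing hPm⟩
  have hinf : ∀ m₁, ∃ m, m₁ ≤ m ∧ (∀ k, m ≠ j k) ∧ P m ≤ maximalIdeal (R m) := by
    intro m₁
    obtain ⟨m, hm, _, hne⟩ := hpos (m₁ + j 0)
    refine ⟨m, by omega, fun kk hkk => ?_, ?_⟩
    · subst hkk
      exact hne (hjP kk)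
    · haveI := (hvis m ⟨hloc m, hne⟩).1
      exact IsLocalRing.le_maximalIdeal (Ideal.IsPrime.ne_top inferInstance)
  have hht : ∀ k, (P (j k)).height = n := by
    intro k
    rw [hjP k]
    have h3 : ((maximalIdeal (R (j k))).height : WithBot ℕ∞) = (n : ℕ∞) := by
      rw [IsLocalRing.maximalIdeal_height_eq_ringKrullDim, hdim]; rfl
    exact WithBot.coe_injective h3
  have hquot : ∀ k, IsRegularLocalRing (R (j k) ⧸ P (j k)) := by
    intro k
    rw [hjP k]
    exact NoSingularCarrier.isRegularLocalRing_quotient_maximalIdeal (R (j k))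
  have hmult' : ∀ k, ∃ g : R (j k), (⟨s (j k) ^ p, hsp (j k)⟩ : R (j k)) - g ^ p ∈ P (j k) ^ p := fun k =>
    hi₁ (j k) (by have := hjN₀ k; omega) ⟨hloc _, hjP k⟩
  have hmin : ∀ k, ∀ (Q : Ideal (R (j k))) [Q.IsPrime], Q < P (j k) →
      IsRegularLocalRing (AdjoinRoot ((X : (Localization.AtPrime Q)[X]) ^ p -
        C (algebraMap (R (j k)) (Localization.AtPrime Q) ⟨s (j k) ^ p, hsp (j k)⟩))) := by
    intro k Q _ hQ
    have hQne : Q ≠ maximalIdeal (R (j k)) := by rw [← hjP k]; exact hQ.ne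
    haveI := hregR (j k)
    obtain ⟨P', hP', hunder, Q', hQ', hlt⟩ :=
      RadicandLocalization.exists_prime_under_eq_of_ne_maximalIdeal p (⟨s (j k) ^ p, hsp (j k)⟩ : R (j k)) Q hQne
    haveI := hP'
    have hregP' := hi₂ (j k) (by have := hjN₀ k; omega) ⟨hloc _, hjP k⟩ P' ⟨Q', hQ', hlt⟩
    exact (RadicandLocalization.isRegularLocalRing_localization_atPrime_iff_of_under_eq p _ Q P' hunder).mp hregP'
  -- ### the exposed chain
  obtain ⟨S, hSloc, hle, f, g, x, e, he, hinf', hreg, hexc, hdim', hqt, hspan, hlaw, hmult'', hiso', hS, hxout⟩ :=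
    StrippedThreadExists.exists_strippedChain_of_thread_out p O A₀ h₀ hfg R P s n hR0 hbl hst hsp hregR
      j hjmono (fun m => maximalIdeal (R m)) (fun m _ => (IsLocalRing.maximalIdeal.isMaximal (R m)).isPrime)
      (fun k => (hjP k).symm) hWcomap hhit hinf hht hquot hmult' hmin hCD
  -- the germs at the visits are the members
  have hSR : ∀ m, S m = R (j (m + 1)) := by
    intro m
    have hT' : ∀ z : K, z ∈ S m ↔ ∃ a b : R (j (m + 1)), b ∉ maximalIdeal (R (j (m + 1))) ∧ z = (a : K) / b := by
      intro z; rw [hS m z, hjP (m + 1)]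
    exact eq_of_locChar_maximalIdeal hT'
  refine ⟨j, hjmono, fun l => ⟨hloc _, hjP l⟩, fun m hm hnv => ⟨hloc m, hposnv m hm hnv⟩,
    S, hSloc, hle, f, g, x, e, he, hinf', hreg, hexc, hdim', hqt, hspan, hlaw, hmult'',
    fun m => hH (j (m + 1)) (S m) (hSR m) (f m) (g m), fun m => hperf (j (m + 1)) (S m) (hSR m), hiso', hSR, fun m => ?_⟩
  obtain ⟨⟨hx, hxP⟩, hx0, hxmax⟩ := hxout m
  refine ⟨⟨hx, hloc _, (hjP (m + 1)) ▸ hxP⟩, hx0, fun y ⟨_, hy⟩ => hxmax y ?_⟩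
  rw [hjP (m + 1)]
  exact hy

end Summit.ResolutionOfSingularities.ResolutionOfSingularities.Theorems.SwitchingDichotomy.PointTail

end
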